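import Summits.QuantumFields.GaugeBoot.ZdLatticePoincare
import Summits.QuantumFields.GaugeBoot.ZdCentralTwistWalks
import HarnessLib

/-!
# Any two `{1, z}`-valued Kogut–Susskind staggerings of `ℤ^d` are gauge equivalent; the loop sign
# rule `hol_C ↦ z^{a(C)} hol_C` for every such staggering (gauge-boot, L3 structural supplement;
# `ℤ^d` twist 11)

HONEST FRAMING (cell `pub-gaugeboot`, page 1 of every file): the venture produces certified bounds
on lattice expectations at stated coupling, gauge group, dimension and torus size; NOT a mass gap,
NOT a continuum limit, NOT a string tension; NOT Yang–Mills-summit-bearing (barriers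
`FixedCouplingUltralocality`, `PerturbativeInvisibility`). This module bounds no expectation; no
certificate of the cell sits at `β < 0`. Structural bookkeeping: it removes the dependence of parts
1–10 of the `ℤ^d` twist on the particular parity staggering `stagTwist π r z`.

A `ℤ/2`-cochain `c : ZdEdge d → ℤ/2` gives the link weights `z^{c}` (`zpow₂ z ∘ c`; `z` central,
`z² = 1`); it is a **Kogut–Susskind cochain** (`IsKSCochain c`) when its sum around every plaquette is
`1` — exactly the staggerings of `(ℤ^d, zdUnit)` with values in `{1, z}` (`IsKSCochain.isStaggering`;
for `SU(2)`, `SU(2n)`, `U(N)` the centre has the single involution `-1`, so these are all of them).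
The parity cochains `stagParity π r` are KS cochains (`isKSCochain_stagParity`). Using the discrete
Poincaré lemma (`ZdLatticePoincare.lean`):

* `IsKSCochain.add` — two KS cochains differ by a CURL-FREE cochain, hence (Poincaré) by a gradient;
  `centralTwist_zpow₂_latticeGrad_eq_gaugeTransformZd` — the twist by `z^{grad φ}` IS the gauge
  transformation by `z^{φ}`; `centralTwist_zpow₂_add` (twists compose additively);
* ★★ `IsKSCochain.exists_gauge` — **any two `{1,z}`-valued KS staggerings `T₁, T₂` of `ℤ^d` satisfy
  `T₁ = g ∘ T₂` for a gauge transformation `g` by central elements**; so `F ∘ T₁ = F ∘ T₂` for every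
  gauge-invariant observable (`IsKSCochain.apply_centralTwist_eq`) and `μ ∘ T₁⁻¹ = μ ∘ T₂⁻¹` for every
  gauge-invariant measure (`IsKSCochain.map_centralTwist_eq`): every gauge-invariant statement of parts
  1–10 about `stagTwist π r z` holds verbatim for every such staggering;
* `walkSign_mul`, `walkSign_zpow₂_latticeGrad` (`= z^{φ(x) + φ(y)}` on `w : x ⟶ y`, so `1` on closed
  walks) and ★★ `IsKSCochain.walkSign_closed` / `IsKSCochain.walkHolonomy_centralTwist_closed` —
  **`hol_C(T_c U) = z^{a(C)} · hol_C(U)` for EVERY closed walk `C` and EVERY KS cochain `c`**, with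
  `a(C) = areaParity π C` the lattice area parity of part 8 (independent of `π`, `r`, and now of `c`).

What is NOT claimed: staggerings with values outside `{1, z}` (possible only for groups whose centre
has several involutions, e.g. `SO(4n)`) are not treated; nothing on tori (where `H¹ ≠ 0`: flat `ℤ/2`
connections carry holonomies around the cycles). [folklore] bookkeeping.
-/

noncomputable section

open MeasureTheory SimpleGraph
open Literature.Probability.LatticeModels (Site zdGraph)
open Literature.MathematicalPhysics.QuantumLattice

namespace Summit.QuantumFields.GaugeBoot

namespace TiltedRP

open ZdPoincare

variable {d N : ℕ} {G : Type*} [Group G]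

/-! ## Kogut–Susskind cochains -/

section KS

/-- **A Kogut–Susskind `ℤ/2`-cochain**: the sum of `c` around every plaquette is `1`
(the sign rule `η₁ + η₂ + η₃ + η₄ = 1`). [shape] A hypothesis (a `Prop`), asserting nothing. [folklore] -/
def IsKSCochain (c : ZdEdge d → ZMod 2) : Prop :=
  ∀ (x : Site d) (k l : Fin d), k ≠ l →
    c (x, k) + c (x + Pi.single k 1, l) + c (x + Pi.single l 1, k) + c (x, l) = 1

variable {z : G} {π : Fin d → Site d →+ ZMod 2}

/-- **The parity cochains are KS cochains** (`stagParity_plaquette`). -/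
theorem isKSCochain_stagParity (hπ : IsDualParity (zdUnit d) π) (r : Fin d) :
    IsKSCochain (stagParity π r) :=
  fun x _ _ hkl => stagParity_plaquette hπ r x hkl

/-- The parity staggering is the twist by `z^{stagParity}`. -/
theorem stagTwist_eq_comp (π : Fin d → Site d →+ ZMod 2) (r : Fin d) (z : G) :
    stagTwist π r z = zpow₂ z ∘ stagParity π r := rfl

/-- `z^a` is central. -/
theorem zpow₂_comm (hzc : ∀ g : G, z * g = g * z) (a : ZMod 2) (g : G) :
    zpow₂ z a * g = g * zpow₂ z a := by
  unfold zpow₂; split_ifs <;> simp [hzc]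

/-- `z^a` is an involution (`z² = 1`). -/
theorem zpow₂_mul_self (hz2 : z * z = 1) (a : ZMod 2) : zpow₂ z a * zpow₂ z a = 1 := by
  unfold zpow₂; split_ifs <;> simp [hz2]

/-- `(z^a)⁻¹ = z^a`. -/
theorem zpow₂_inv (hz2 : z * z = 1) (a : ZMod 2) : (zpow₂ z a)⁻¹ = zpow₂ z a :=
  inv_eq_of_mul_eq_one_right (zpow₂_mul_self hz2 a)

/-- **A KS cochain defines a staggering with values in `{1, z}`.** -/
theorem IsKSCochain.isStaggering {c : ZdEdge d → ZMod 2} (hc : IsKSCochain c)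
    (hzc : ∀ g : G, z * g = g * z) (hz2 : z * z = 1) : IsStaggering (zdUnit d) z (zpow₂ z ∘ c) where
  comm l g := zpow₂_comm hzc _ g
  mul_self l := zpow₂_mul_self hz2 _
  plaq x k l hkl := by
    simp only [Function.comp_apply, zdUnit_apply]
    rw [← zpow₂_add hz2, ← zpow₂_add hz2, ← zpow₂_add hz2, hc x k l hkl]
    simp [zpow₂]

/-- **Two KS cochains differ by a curl-free cochain** (over `ℤ/2` the two sign rules add up to `0`). -/
theorem IsKSCochain.add {c₁ c₂ : ZdEdge d → ZMod 2} (h₁ : IsKSCochain c₁) (h₂ : IsKSCochain c₂) :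
    IsCurlFree (c₁ + c₂) := by
  intro x k l
  simp only [Pi.add_apply]
  rcases eq_or_ne k l with rfl | hkl
  · rfl
  have e₁ := h₁ x k l hkl
  have e₂ := h₂ x k l hkl
  have h2 : ∀ u v : ZMod 2, u + u = v + v := by decide
  -- in characteristic 2: `a + b = c + d ↔ a + b + c + d = 0`
  have key : c₁ (x, k) + c₂ (x, k) + (c₁ (x + Pi.single k 1, l) + c₂ (x + Pi.single k 1, l)) +
      (c₁ (x, l) + c₂ (x, l) + (c₁ (x + Pi.single l 1, k) + c₂ (x + Pi.single l 1, k))) = 0 := by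
    calc _ = (c₁ (x, k) + c₁ (x + Pi.single k 1, l) + c₁ (x + Pi.single l 1, k) + c₁ (x, l)) +
          (c₂ (x, k) + c₂ (x + Pi.single k 1, l) + c₂ (x + Pi.single l 1, k) + c₂ (x, l)) := by ring
      _ = 0 := by rw [e₁, e₂]; decide
  have hab : ∀ a b : ZMod 2, a + b = 0 → a = b := by decide
  exact hab _ _ key

/-- **A KS cochain plus a curl-free cochain is a KS cochain** (the KS cochains form a torsor under
the curl-free ones). -/
theorem IsKSCochain.add_isCurlFree {c b : ZdEdge d → ZMod 2} (hc : IsKSCochain c)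
    (hb : IsCurlFree b) : IsKSCochain (c + b) := by
  intro x k l hkl
  simp only [Pi.add_apply]
  have e₁ := hc x k l hkl
  have e₂ := hb x k l
  have hab : ∀ a b' : ZMod 2, a = b' → a + b' = 0 := by decide
  have e₂' := hab _ _ e₂
  calc _ = (c (x, k) + c (x + Pi.single k 1, l) + c (x + Pi.single l 1, k) + c (x, l)) +
        (b (x, k) + b (x + Pi.single k 1, l) + (b (x, l) + b (x + Pi.single l 1, k))) := by ring
    _ = 1 := by rw [e₁, e₂', add_zero]

end KS

/-! ## Exact cochains twist by gauge transformations; any two KS staggerings are gauge equivalent -/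

section Gauge

variable {z : G}

/-- **The twist by `z^{grad φ}` is the gauge transformation by `z^{φ}`** (central values). -/
theorem centralTwist_zpow₂_latticeGrad_eq_gaugeTransformZd (hzc : ∀ g : G, z * g = g * z)
    (hz2 : z * z = 1) (φ : Site d → ZMod 2) (U : LGConfig d G) :
    centralTwist (zpow₂ z ∘ latticeGrad φ) U = gaugeTransformZd (fun x => zpow₂ z (φ x)) U := by
  funext l
  obtain ⟨x, m⟩ := l
  rw [centralTwist_apply, Function.comp_apply, latticeGrad_apply]
  simp only [gaugeTransformZd]
  rw [zpow₂_inv hz2, mul_assoc, ← zpow₂_comm hzc, ← mul_assoc, ← zpow₂_add hz2]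
  congr 2
  rw [sub_eq_add_neg, ZMod.neg_eq_self_mod_two, add_comm]

/-- **The twist by a curl-free `{1,z}`-cochain is a gauge transformation** (discrete Poincaré lemma). -/
theorem centralTwist_zpow₂_eq_gaugeTransformZd_of_isCurlFree (hzc : ∀ g : G, z * g = g * z)
    (hz2 : z * z = 1) {b : ZdEdge d → ZMod 2} (hb : IsCurlFree b) (U : LGConfig d G) :
    centralTwist (zpow₂ z ∘ b) U = gaugeTransformZd (fun x => zpow₂ z (potential b x)) U := by
  rw [← centralTwist_zpow₂_latticeGrad_eq_gaugeTransformZd hzc hz2, latticeGrad_potential hb]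

/-- **Twists compose additively**: `T_{b + c} = T_b ∘ T_c`. -/
theorem centralTwist_zpow₂_add (hz2 : z * z = 1) (b c : ZdEdge d → ZMod 2) (U : LGConfig d G) :
    centralTwist (zpow₂ z ∘ (b + c)) U = centralTwist (zpow₂ z ∘ b) (centralTwist (zpow₂ z ∘ c) U) := by
  funext l
  simp only [centralTwist_apply, Function.comp_apply, Pi.add_apply, zpow₂_add hz2, mul_assoc]

/-- ★★ **Any two `{1,z}`-valued KS staggerings of `ℤ^d` are gauge equivalent**: `T₁ = g ∘ T₂` with
the gauge function `g = z^{potential (c₁ + c₂)}` (central values). -/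
theorem IsKSCochain.exists_gauge {c₁ c₂ : ZdEdge d → ZMod 2} (h₁ : IsKSCochain c₁)
    (h₂ : IsKSCochain c₂) (hzc : ∀ g : G, z * g = g * z) (hz2 : z * z = 1) :
    ∃ k : Site d → G, (∀ x g, k x * g = g * k x) ∧
      ∀ U : LGConfig d G, centralTwist (zpow₂ z ∘ c₁) U =
        gaugeTransformZd k (centralTwist (zpow₂ z ∘ c₂) U) := by
  refine ⟨fun x => zpow₂ z (potential (c₁ + c₂) x), fun x g => zpow₂_comm hzc _ g, fun U => ?_⟩
  have hc : c₁ = (c₁ + c₂) + c₂ := by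
    funext l
    have h : ∀ a b : ZMod 2, a = a + b + b := by decide
    exact h _ _
  rw [← centralTwist_zpow₂_eq_gaugeTransformZd_of_isCurlFree hzc hz2 (h₁.add h₂),
    ← centralTwist_zpow₂_add hz2, ← hc]

/-- In particular every `{1,z}`-valued KS staggering is gauge equivalent to the parity staggering
`stagTwist π r z` (any dual parities `π`, any last axis `r`). -/
theorem IsKSCochain.exists_gauge_stagTwist {c : ZdEdge d → ZMod 2} (hc : IsKSCochain c)
    {π : Fin d → Site d →+ ZMod 2} (hπ : IsDualParity (zdUnit d) π) (r : Fin d)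
    (hzc : ∀ g : G, z * g = g * z) (hz2 : z * z = 1) :
    ∃ k : Site d → G, (∀ x g, k x * g = g * k x) ∧
      ∀ U : LGConfig d G, centralTwist (zpow₂ z ∘ c) U =
        gaugeTransformZd k (centralTwist (stagTwist π r z) U) :=
  hc.exists_gauge (isKSCochain_stagParity hπ r) hzc hz2

/-- ★ **Gauge-invariant observables do not distinguish KS staggerings**: `F (T₁ U) = F (T₂ U)`. -/
theorem IsKSCochain.apply_centralTwist_eq {c₁ c₂ : ZdEdge d → ZMod 2} (h₁ : IsKSCochain c₁)
    (h₂ : IsKSCochain c₂) (hzc : ∀ g : G, z * g = g * z) (hz2 : z * z = 1) {α : Type*}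
    {F : LGConfig d G → α} (hF : IsZdGaugeInvariant F) (U : LGConfig d G) :
    F (centralTwist (zpow₂ z ∘ c₁) U) = F (centralTwist (zpow₂ z ∘ c₂) U) := by
  obtain ⟨k, -, hk⟩ := h₁.exists_gauge h₂ hzc hz2
  rw [hk U, hF k]

variable [TopologicalSpace G] [IsTopologicalGroup G] [MeasurableSpace G] [BorelSpace G]

/-- ★ **Gauge-invariant states do not distinguish KS staggerings**: `μ ∘ T₁⁻¹ = μ ∘ T₂⁻¹`. -/
theorem IsKSCochain.map_centralTwist_eq {c₁ c₂ : ZdEdge d → ZMod 2} (h₁ : IsKSCochain c₁)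
    (h₂ : IsKSCochain c₂) (hzc : ∀ g : G, z * g = g * z) (hz2 : z * z = 1)
    {μ : Measure (LGConfig d G)} (hμG : ∀ k : Site d → G, μ.map (gaugeTransformZd k) = μ) :
    μ.map (centralTwist (zpow₂ z ∘ c₁)) = μ.map (centralTwist (zpow₂ z ∘ c₂)) := by
  obtain ⟨k, -, hk⟩ := h₁.exists_gauge h₂ hzc hz2
  have hT := measurable_centralTwist (d := d) (A := Site d) (G := G) (zpow₂ z ∘ c₂)
  rw [show (centralTwist (zpow₂ z ∘ c₁) : LGConfig d G → LGConfig d G) =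
      gaugeTransformZd k ∘ centralTwist (zpow₂ z ∘ c₂) from funext hk,
    ← Measure.map_map (measurable_gaugeTransformZd k) hT]
  exact map_gaugeTransformZd_map_centralTwist (fun l g => zpow₂_comm hzc _ g) hμG k

/-- The same against the parity staggering: `μ ∘ T_c⁻¹ = μ ∘ (stagTwist π r z)⁻¹` for gauge-invariant
`μ` — so every statement of parts 1–10 about the twisted STATE holds for every KS staggering. -/
theorem IsKSCochain.map_centralTwist_eq_stagTwist {c : ZdEdge d → ZMod 2} (hc : IsKSCochain c)
    {π : Fin d → Site d →+ ZMod 2} (hπ : IsDualParity (zdUnit d) π) (r : Fin d)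
    (hzc : ∀ g : G, z * g = g * z) (hz2 : z * z = 1) {μ : Measure (LGConfig d G)}
    (hμG : ∀ k : Site d → G, μ.map (gaugeTransformZd k) = μ) :
    μ.map (centralTwist (zpow₂ z ∘ c)) = μ.map (centralTwist (stagTwist π r z)) :=
  hc.map_centralTwist_eq (isKSCochain_stagParity hπ r) hzc hz2 hμG

end Gauge

/-! ## The loop sign rule for every KS staggering -/

section Loops

variable {z : G}

/-- **The collected weight is multiplicative** in the link weights (central first factor). -/
theorem walkSign_mul {s₁ s₂ : ZdEdge d → G} (h₁ : ∀ l g, s₁ l * g = g * s₁ l) {x y : Site d}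
    (w : (zdGraph d).Walk x y) :
    walkSign (fun l => s₁ l * s₂ l) w = walkSign s₁ w * walkSign s₂ w := by
  induction w with
  | nil => simp
  | cons h w ih =>
    rw [walkSign_cons, walkSign_cons, walkSign_cons, ih]
    -- `a b (W₁ W₂) = (a W₁) (b W₂)` with `W₁` central
    simp only [mul_assoc]
    rw [← mul_assoc (s₂ _) (walkSign s₁ w), ← walkSign_comm h₁ w, mul_assoc]

/-- The endpoints of the link under a dart: `{base, base + e_dir} = {start, end}`; over `ℤ/2` the
gradient along the link is `φ(start) + φ(end)` whatever the orientation. -/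
theorem latticeGrad_dartStep (φ : Site d → ZMod 2) (e : (zdGraph d).Dart) :
    latticeGrad φ (dartStep e).1 = φ e.fst + φ e.snd := by
  unfold dartStep
  split_ifs with h
  · rw [latticeGrad_apply, ← h, sub_eq_add_neg, ZMod.neg_eq_self_mod_two, add_comm]
  · rw [latticeGrad_apply, ← (dartDir_spec e).resolve_left h, sub_eq_add_neg, ZMod.neg_eq_self_mod_two]

/-- **An exact cochain collects `z^{φ(x) + φ(y)}` along `w : x ⟶ y`** — so `1` along a closed walk. -/
theorem walkSign_zpow₂_latticeGrad (hz2 : z * z = 1) (φ : Site d → ZMod 2) {x y : Site d}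
    (w : (zdGraph d).Walk x y) : walkSign (zpow₂ z ∘ latticeGrad φ) w = zpow₂ z (φ x + φ y) := by
  induction w with
  | nil =>
    have h : ∀ a : ZMod 2, a + a = 0 := by decide
    simp [h, zpow₂]
  | @cons u v y' h w ih =>
    rw [walkSign_cons, ih, Function.comp_apply, latticeGrad_dartStep, ← zpow₂_add hz2]
    congr 1
    have h2 : ∀ a b c : ZMod 2, a + b + (b + c) = a + c := by decide
    exact h2 (φ u) (φ v) (φ y')

/-- An exact cochain collects `1` along a closed walk. -/
theorem walkSign_zpow₂_latticeGrad_closed (hz2 : z * z = 1) (φ : Site d → ZMod 2) {x : Site d}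
    (w : (zdGraph d).Walk x x) : walkSign (zpow₂ z ∘ latticeGrad φ) w = 1 := by
  rw [walkSign_zpow₂_latticeGrad hz2 φ w]
  have h : ∀ a : ZMod 2, a + a = 0 := by decide
  simp [h, zpow₂]

variable {π : Fin d → Site d →+ ZMod 2}

/-- ★★ **Every KS staggering collects `z^{a(C)}` along a closed walk `C`** (`a(C) = areaParity π C`, the
lattice area parity): the cochain is the parity cochain plus a gradient, which collects `1`. -/
theorem IsKSCochain.walkSign_closed {c : ZdEdge d → ZMod 2} (hc : IsKSCochain c)
    (hπ : IsDualParity (zdUnit d) π) (hzc : ∀ g : G, z * g = g * z) (hz2 : z * z = 1) {x : Site d}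
    (C : (zdGraph d).Walk x x) : walkSign (zpow₂ z ∘ c) C = zpow₂ z (areaParity π C) := by
  classical
  rcases Nat.eq_zero_or_pos d with hd | hd
  · -- `d = 0`: the walk is trivial (no darts), both sides are `1`
    subst hd
    have hC : C.darts = [] := by
      rcases hC' : C.darts with _ | ⟨e, _⟩
      · rfl
      · exact (Fin.elim0 (dartDir e) : False).elim
    have hA : areaParity π C = 0 := by simp [areaParity]
    simp only [walkSign, hC, hA, List.map_nil, List.prod_nil]
    simp [zpow₂]
  obtain r : Fin d := ⟨0, hd⟩
  -- `c = b + stagParity π r` with `b` curl-free, hence a gradient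
  set b := c + stagParity π r with hb
  have hbf : IsCurlFree b := hc.add (isKSCochain_stagParity hπ r)
  obtain ⟨φ, hφ⟩ := (isCurlFree_iff_exists_latticeGrad b).1 hbf
  have hsplit : (zpow₂ z ∘ c) = fun l => (zpow₂ z ∘ latticeGrad φ) l * stagTwist π r z l := by
    funext l
    rw [Function.comp_apply, Function.comp_apply, hφ, stagTwist, ← zpow₂_add hz2, hb, Pi.add_apply]
    congr 1
    have h : ∀ a s : ZMod 2, a = a + s + s := by decide
    exact h _ _
  rw [hsplit, walkSign_mul (s₁ := zpow₂ z ∘ latticeGrad φ) (s₂ := stagTwist π r z)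
    (fun l g => zpow₂_comm hzc _ g), walkSign_zpow₂_latticeGrad_closed hz2, one_mul,
    walkSign_stagTwist hπ hz2 r, twistParity_eq_areaParity hπ r]

/-- ★★ **`hol_C(T_c U) = z^{a(C)} · hol_C(U)` for every closed walk `C` and EVERY `{1,z}`-valued KS
staggering `c`** (not only the parity staggerings of part 8). -/
theorem IsKSCochain.walkHolonomy_centralTwist_closed {c : ZdEdge d → ZMod 2} (hc : IsKSCochain c)
    (hπ : IsDualParity (zdUnit d) π) (hzc : ∀ g : G, z * g = g * z) (hz2 : z * z = 1)
    (U : LGConfig d G) {x : Site d} (C : (zdGraph d).Walk x x) :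
    walkHolonomy (centralTwist (zpow₂ z ∘ c) U) C = zpow₂ z (areaParity π C) * walkHolonomy U C := by
  rw [(hc.isStaggering hzc hz2).walkHolonomy_centralTwist U C, hc.walkSign_closed hπ hzc hz2 C]

end Loops

end TiltedRP

end Summit.QuantumFields.GaugeBoot
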